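import Summits.MatrixMultiplication.OmegaCensus.SmallFormats.InvertiblePointDeltaLawDataRefined
import Summits.MatrixMultiplication.OmegaCensus.SmallFormats.InvertiblePointMultiColumnClause
import Summits.MatrixMultiplication.OmegaCensus.SmallFormats.InvertiblePointKernelSplit
import HarnessLib

/-!
# ω-census family (a): the δ-LAW, REFINED FORM — `dim K₀ + n ≤ dim span{W_t : t ∉ O}` at a saturated point

Cell `pub-omega` (unit `pub-omega-tensor`, gen 35), topic `Summits/MatrixMultiplication/OmegaCensus` (sub-folder
`SmallFormats`). Framing (verbatim): lottery ticket; floor = certified bounds/negative ranges. HONEST FRAMING: the proof of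
`seven_mul_le_or_of_saturated_one` (`InvertiblePointDeltaLawThree`, p659768, tensor g34) copied with its last three lines changed:
instead of closing the count with `dim K₀ ≥ 2n − |Z|` and `Σ rows ≤ |Z|` (which gives `7n ≤ 2r`), it STOPS at the structural
inequality the block analysis actually proves,
**`finrank K₀ + n ≤ finrank span{W_t : t ∉ O}`** (`K₀ = ⋂_{t∉O} ker g_t`),
valid whenever `k²` has more pairwise independent vectors than `|ι|` (`finrank_ker_add_le_finrank_span`; the general statement
`finrank_ker_add_le_or` keeps the small-field branch). In this form the K-side (`dim span{g_t}`) and the W-side (`dim span{W_t}`)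
of the vanishing terms are charged SEPARATELY: `3n ≤ dim span{g_t : t ∉ O} + dim span{W_t : t ∉ O}`. The near-point law
(`InvertiblePointNearLaw`) applies it to the split computation of `InvertiblePointNearSplit`, whose three defect terms share ONE
Y-form. No new mathematics beyond the bookkeeping; nothing on `ω`.
-/

namespace Summit.MatrixMultiplication.OmegaCensus.SmallFormats

open Module Submodule Matrix Kronecker Kronecker.KBlock DeltaBlocks Literature.Computability.AlgebraicComplexity

namespace DeltaLaw

variable {k : Type*} [Field k] {n : ℕ} {ι : Type*} [Fintype ι] [DecidableEq ι]

/-- **The δ-LAW, refined form (with the small-field branch).** At a saturated `X₀ = 1` of a computation of `⟨2,2,n⟩` over a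
field with `P + 1` pairwise independent vectors in `k²`: `dim K₀ + n ≤ dim span{W_t : t ∉ O}`, unless more than `P` free columns
occur (then `2(P + 1) ≤ |ι|`, as each contributes two dimensions to `span{W_t}`). -/
theorem finrank_ker_add_le_or (P : ℕ) (xs : Fin (P + 1) → (Fin 2 → k))
    (hxs : ∀ i j, i ≠ j → xs i 0 * xs j 1 - xs i 1 * xs j 0 ≠ 0)
    (β : BilinComp (mulBilin k 2 2 n) ι) (O : Finset ι)
    (hO : ∀ i, i ∉ O → β.f i 1 = 0) (hO' : ∀ i ∈ O, β.f i 1 ≠ 0) (hcard : O.card = 2 * n) :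
    finrank k ↥(LinearMap.ker (LinearMap.pi fun t : ↥(Finset.univ \ O) => β.g (t : ι))) + n ≤
        finrank k ↥(Submodule.span k (Set.range fun t : ↥(Finset.univ \ O) => β.w (t : ι))) ∨
      2 * (P + 1) ≤ Fintype.card ι := by
  classical
  obtain ⟨N, blk, bF, M, hMapply, hM, noL, hδ, hdimK, hrows, hcols⟩ :=
    exists_saturated_blockData' β O hO hO' hcard
  have h𝒲le : finrank k ↥(Submodule.span k (Set.range fun t : ↥(Finset.univ \ O) => β.w (t : ι))) ≤ Fintype.card ι :=
    (finrank_range_le_card _).trans (by rw [Fintype.card_coe]; exact Finset.card_le_univ _)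
  set K₀ := LinearMap.ker (LinearMap.pi fun t : ↥(Finset.univ \ O) => β.g (t : ι)) with hK₀
  let J := Σ i : Fin N, Fin (blk i).cols
  let π : ∀ i : Fin N, Matrix (Fin 2) (Fin n) k →ₗ[k] Matrix (Fin 2) (Fin (blk i).cols) k :=
    fun i => (mulBilin k 2 n (blk i).cols).flip (M i)
  have hπ : ∀ i W, π i W = W * M i := fun i W => by simp [π, LinearMap.flip_apply, mulBilin_apply]
  -- the `L₁ᵀ` blocks and a subset `T` of `m = min(x, P)` of them
  set LT1s : Finset (Fin N) := Finset.univ.filter fun i => blk i = KBlock.LT 1 with hLT1s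
  set m := min LT1s.card P with hm
  obtain ⟨T, hTsub, hTcard⟩ := Finset.exists_subset_card_eq (show m ≤ LT1s.card from min_le_left _ _)
  have hT1 : ∀ b ∈ T, blk b = KBlock.LT 1 := fun b hb => (Finset.mem_filter.mp (hTsub hb)).2
  have hTc : ∀ b ∈ T, 0 < (blk b).cols := fun b hb => by rw [hT1 b hb]; exact Nat.one_pos
  have hTc' : ∀ b ∈ T, (blk b).cols = 1 := fun b hb => by rw [hT1 b hb]; rfl
  -- `E` = matrices all of whose row coordinates outside the `T`-columns vanish
  let E : Submodule k (Matrix (Fin 2) (Fin n) k) :=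
    { carrier := {W | ∀ q : J, q.1 ∉ T → ∀ s, bF.coord q (W s) = 0}
      add_mem' := by
        intro W W' hW hW' q hq s
        change bF.coord q (W s + W' s) = 0
        rw [map_add, hW q hq s, hW' q hq s, add_zero]
      zero_mem' := by
        intro q _ s
        change bF.coord q (0 : Fin n → k) = 0
        rw [map_zero]
      smul_mem' := by
        intro c W hW q hq s
        change bF.coord q (c • W s) = 0
        rw [map_smul, hW q hq s, smul_zero] }
  have memE : ∀ W : Matrix (Fin 2) (Fin n) k, W ∈ E ↔ ∀ q : J, q.1 ∉ T → ∀ s, bF.coord q (W s) = 0 := fun W => Iff.rfl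
  -- (a) the joint kernel of the `π i`, `i ∉ T`, inside `E`
  have hEker : ∀ W ∈ K₀, (∀ i, i ∉ T → π i W = 0) → W ∈ E := by
    intro W _ hWi
    rw [memE]
    rintro ⟨i, c⟩ hi s
    rw [← hMapply i W s c, ← hπ, hWi i hi, Matrix.zero_apply]
  -- (b) the clause data: `ρ : Fin m → kⁿ`, the `T`-columns
  have eT' : Fin m ≃ ↥T := by rw [← hTcard]; exact T.equivFin.symm
  let g : Fin m → J := fun l => ⟨(eT' l : Fin N), ⟨0, hTc _ (eT' l).2⟩⟩
  have hg : Function.Injective g := by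
    intro l l' h
    have h1 : ((eT' l : Fin N)) = (eT' l' : Fin N) := congrArg Sigma.fst h
    exact eT'.injective (Subtype.ext h1)
  let ρ : Fin m → (Fin n → k) := fun l => bF (g l)
  have hρ : LinearIndependent k ρ := bF.linearIndependent.comp g hg
  have hE : ∀ (x : Fin 2 → k), ∀ w ∈ Submodule.span k (Set.range ρ), vecMulVec x w ∈ E := by
    intro x w hw
    rw [memE]
    rintro q hq s
    rw [show (vecMulVec x w) s = x s • w from by funext j; simp [vecMulVec_apply], map_smul, smul_eq_mul]
    suffices h : bF.coord q w = 0 by rw [h, mul_zero]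
    have hle : Submodule.span k (Set.range ρ) ≤ LinearMap.ker (bF.coord q) := by
      refine Submodule.span_le.mpr ?_
      rintro _ ⟨l, rfl⟩
      rw [SetLike.mem_coe, LinearMap.mem_ker, Basis.coord_apply, Basis.repr_self, Finsupp.single_apply, if_neg]
      intro h
      exact hq (h ▸ (eT' l).2)
    exact hle hw
  have hEdim : finrank k E ≤ 2 * m := by
    -- `E` embeds into `(Fin 2 × Fin m) → k` by the `T`-coordinates
    let φ : E →ₗ[k] (Fin 2 × Fin m → k) :=
      { toFun := fun W p => bF.coord (g p.2) ((W : Matrix (Fin 2) (Fin n) k) p.1)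
        map_add' := fun W W' => by
          funext p
          change bF.coord (g p.2) ((W : Matrix (Fin 2) (Fin n) k) p.1 + (W' : Matrix (Fin 2) (Fin n) k) p.1) = _
          rw [map_add]; rfl
        map_smul' := fun c W => by
          funext p
          change bF.coord (g p.2) (c • (W : Matrix (Fin 2) (Fin n) k) p.1) = _
          rw [map_smul]; rfl }
    have hφ : Function.Injective φ := by
      intro W W' h
      apply Subtype.ext
      have hdiff : ∀ s, ∀ q : J, bF.coord q (((W : Matrix (Fin 2) (Fin n) k) - W') s) = 0 := by
        intro s q
        rw [show ((W : Matrix (Fin 2) (Fin n) k) - W') s = (W : Matrix (Fin 2) (Fin n) k) s - (W' : Matrix _ _ k) s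
          from rfl, map_sub]
        by_cases hq : q.1 ∈ T
        · -- a `T`-coordinate: read off `φ`
          set l := eT'.symm ⟨q.1, hq⟩ with hldef
          have hl : eT' l = ⟨q.1, hq⟩ := eT'.apply_symm_apply _
          have h1 : (g l).1 = q.1 := by
            change ((eT' l : Fin N)) = q.1
            rw [hl]
          have hgl : g l = q := by
            refine Sigma.ext h1 ((Fin.heq_ext_iff (by rw [h1])).mpr ?_)
            have hq2 : (q.2 : ℕ) < 1 := lt_of_lt_of_eq q.2.2 (hTc' q.1 hq)
            change (0 : ℕ) = (q.2 : ℕ)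
            omega
          have := congr_fun h (s, l)
          simp only [φ, LinearMap.coe_mk, AddHom.coe_mk, hgl] at this
          rw [this, sub_self]
        · rw [(memE _).mp W.2 q hq s, (memE _).mp W'.2 q hq s, sub_self]
      have : (W : Matrix (Fin 2) (Fin n) k) - W' = 0 := by
        ext s j
        have hz : ((W : Matrix (Fin 2) (Fin n) k) - W') s = 0 :=
          (bF.forall_coord_eq_zero_iff).mp fun q => hdiff s q
        rw [hz]; rfl
      exact sub_eq_zero.mp this
    calc finrank k E ≤ finrank k (Fin 2 × Fin m → k) := LinearMap.finrank_le_finrank_of_injective hφ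
      _ = 2 * m := by rw [finrank_fintype_fun_eq_card, Fintype.card_prod, Fintype.card_fin, Fintype.card_fin]
  -- (c) the multi-column clause: `dim (K₀ ⊓ E) ≤ m` (using `m + 1 ≤ P + 1` of the points)
  have hKE : finrank k ↥(K₀ ⊓ E) ≤ m := by
    have hmP : m + 1 ≤ P + 1 := by omega
    refine multi_column_clause β O hO hO' hcard ρ hρ (fun i => xs (Fin.castLE hmP i))
      (fun i j hij => hxs _ _ fun h => hij (Fin.castLE_injective hmP h)) K₀ ?_ E hE hEdim
    intro W hW t ht
    have := LinearMap.mem_ker.mp hW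
    have h' := congr_fun this ⟨t, Finset.mem_sdiff.mpr ⟨Finset.mem_univ t, ht⟩⟩
    simpa using h'
  -- (d) kernel split: `dim K₀ ≤ m + Σ_{i ∉ T} δ(blk i)`, and `Σ_{i ∈ T} δ = 2m`
  have hsplit := finrank_le_inf_add_sum K₀ π (fun i => i ∉ T) E hEker
  have hsumT : ∑ i : {i : Fin N // i ∉ T}, finrank k ↥(K₀.map (π (i : Fin N))) ≤ ∑ i ∈ Tᶜ, (blk i).delta :=
    calc ∑ i : {i : Fin N // i ∉ T}, finrank k ↥(K₀.map (π (i : Fin N)))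
        ≤ ∑ i : {i : Fin N // i ∉ T}, (blk i).delta := Finset.sum_le_sum fun i _ => hδ i
      _ = ∑ i ∈ Tᶜ, (blk i).delta :=
        (Finset.sum_subtype Tᶜ (fun i => by simp [Finset.mem_compl]) (fun i => (blk i).delta)).symm
  have hdeltaT : ∑ i ∈ T, (blk i).delta = 2 * m := by
    rw [Finset.sum_congr rfl (g := fun _ => 2) (fun i hi => by rw [hT1 i hi]; rfl)]
    rw [Finset.sum_const, smul_eq_mul, hTcard, mul_comm]
  have hdelta_split : ∑ i, (blk i).delta = ∑ i ∈ T, (blk i).delta + ∑ i ∈ Tᶜ, (blk i).delta :=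
    (Finset.sum_add_sum_compl T _).symm
  have hK : finrank k K₀ + m ≤ ∑ i, (blk i).delta := by rw [hdelta_split, hdeltaT]; omega
  -- (e) counting
  have hsum2 : ∑ i, (blk i).delta + 2 * ∑ i, (blk i).cols ≤ 2 * ∑ i, (blk i).rows := by
    rw [Finset.mul_sum, Finset.mul_sum, ← Finset.sum_add_distrib]
    exact Finset.sum_le_sum fun i _ => delta_add_le_of_ne_L (blk i) (noL i)
  have hsum1 : ∑ i, (blk i).delta + ∑ i, (blk i).cols ≤ ∑ i, (blk i).rows + LT1s.card := by
    have key : ∀ i, (blk i).delta + (blk i).cols ≤ (blk i).rows + if blk i = KBlock.LT 1 then 1 else 0 := by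
      intro i
      by_cases hi : blk i = KBlock.LT 1
      · rw [if_pos hi, hi]; simp [rows, cols, delta]
      · rw [if_neg hi, add_zero]; exact delta_add_le_of_ne_LT_one (blk i) (noL i) hi
    have := Finset.sum_le_sum fun i (_ : i ∈ Finset.univ) => key i
    rw [Finset.sum_add_distrib, Finset.sum_add_distrib, Finset.sum_boole] at this
    simpa [hLT1s] using this
  have hLTle : LT1s.card + ∑ i, (blk i).cols ≤ ∑ i, (blk i).rows := by
    have key : ∀ i, (if blk i = KBlock.LT 1 then 1 else 0) + (blk i).cols ≤ (blk i).rows := by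
      intro i
      by_cases hi : blk i = KBlock.LT 1
      · rw [if_pos hi, hi]; simp [rows, cols]
      · rw [if_neg hi, zero_add]; exact cols_le_rows_of_ne_L (blk i) (noL i)
    have := Finset.sum_le_sum fun i (_ : i ∈ Finset.univ) => key i
    rw [Finset.sum_add_distrib, Finset.sum_boole] at this
    simpa [hLT1s] using this
  -- the `L₁ᵀ` blocks have two rows each: `2·#LT1 ≤ Σ rows`
  have hLT1rows : 2 * LT1s.card ≤ ∑ i, (blk i).rows := by
    have key : ∀ i, 2 * (if blk i = KBlock.LT 1 then 1 else 0) ≤ (blk i).rows := by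
      intro i
      by_cases hi : blk i = KBlock.LT 1
      · rw [if_pos hi, hi]; simp [rows]
      · rw [if_neg hi]; simp
    have := Finset.sum_le_sum fun i (_ : i ∈ Finset.univ) => key i
    rw [← Finset.mul_sum, Finset.sum_boole] at this
    simpa [hLT1s] using this
  by_cases hx : LT1s.card ≤ P
  · have hmx : m = LT1s.card := min_eq_left hx
    left; omega
  · right
    have h2 : 2 * (P + 1) ≤ ∑ i, (blk i).rows := by omega
    rw [hrows] at h2
    exact h2.trans h𝒲le

/-- **The δ-LAW, refined form.** At a saturated `X₀ = 1` (`|O| = 2n`) of an `r`-term computation of `⟨2,2,n⟩` over a field with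
at least `r + 1` pairwise independent vectors in `k²`: `dim (⋂_{t∉O} ker g_t) + n ≤ dim span{W_t : t ∉ O}`. Together with
`dim ⋂ ker g_t = 2n − dim span{g_t}` this reads `3n ≤ dim span{g_t : t ∉ O} + dim span{W_t : t ∉ O}`; with both spans of dimension
`≤ |Z| = r − 2n` it is the final δ-law `7n ≤ 2r`. -/
theorem finrank_ker_add_le_finrank_span (P : ℕ) (xs : Fin (P + 1) → (Fin 2 → k))
    (hxs : ∀ i j, i ≠ j → xs i 0 * xs j 1 - xs i 1 * xs j 0 ≠ 0) (hP : Fintype.card ι ≤ P)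
    (β : BilinComp (mulBilin k 2 2 n) ι) (O : Finset ι)
    (hO : ∀ i, i ∉ O → β.f i 1 = 0) (hO' : ∀ i ∈ O, β.f i 1 ≠ 0) (hcard : O.card = 2 * n) :
    finrank k ↥(LinearMap.ker (LinearMap.pi fun t : ↥(Finset.univ \ O) => β.g (t : ι))) + n ≤
      finrank k ↥(Submodule.span k (Set.range fun t : ↥(Finset.univ \ O) => β.w (t : ι))) := by
  rcases finrank_ker_add_le_or P xs hxs β O hO hO' hcard with h | h <;> omega

end DeltaLaw

end Summit.MatrixMultiplication.OmegaCensus.SmallFormats
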